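import Summits.MatrixMultiplication.OmegaCensus.STPPVosperSlackTwoCheckersTP
import Summits.MatrixMultiplication.OmegaCensus.STPPVosperSlackTwoTablesZ53
import Summits.MatrixMultiplication.OmegaCensus.STPPVosperSlackTwoLawABQ

/-!
# ω-census (abelian STPP census): ℤ₅₃ leaf {(2,3,3)³} — slack-2 three-block law, case C rows, part 5 (kernel computations)

HONEST FRAMING (pub-omega census; verbatim): lottery ticket; floor = certified bounds/negative ranges.
Census STRUCTURE (seat pub-omega-stpp-2 gen 31, 2026-08-29), family (b2).  Rows for the three-block slack-2 law `no_isSTPP_of_slack_two_tables`, case C (PRUNED checker `caseCDeadTP` of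
`STPPVosperSlackTwoCheckersTP.lean`, dead table `tblZ53C = []` of `…TablesZ53.lean` — at `p = 53` no case-C leaf is reached):
`caseCDeadTP 53 3 18 12 Q P h₀ tblZ53C = true` for `Q ∈ qShapesC 3`, `P ∈ pShapesC 53 2` (52 shapes `[0, d]`), `h₀ ∈ [1, 12]`.  Light `P`-ranges are one `decide` each;
the four heavy `P` (`d = 3, 4, 49, 50`) are split by `Q` and glued back in the same file; every `decide` ≤ 15000 mirror units (HOME `pub-omega-stpp-2-g31/code/s2/units53.py`,
farm calibration of the ℤ₅₉ programme ≈ 3.9 ms/unit).  Assembly in `STPPVosperSlackTwoRows53CAsm.lean`.  Nothing here is progress on `ω`.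
-/

namespace Summit.MatrixMultiplication.OmegaCensus.CubeNB.S2

/-- `(Q, P) = ([0, 2, 3], [0, 50])`, all holes `[1, 12]`: one `decide`. [folklore] -/
theorem rows53C_p49_q0 : ((List.range' 1 12).all fun h₀ => caseCDeadTP 53 3 18 12 [0, 2, 3] [0, 50] h₀ tblZ53C) = true := by
  decide +kernel

/-- `(Q, P) = ([0, 1, 3], [0, 50])`, all holes `[1, 12]`: one `decide`. [folklore] -/
theorem rows53C_p49_q1 : ((List.range' 1 12).all fun h₀ => caseCDeadTP 53 3 18 12 [0, 1, 3] [0, 50] h₀ tblZ53C) = true := by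
  decide +kernel

/-- `(Q, P) = ([0, 1, 2], [0, 50])`, all holes `[1, 12]`: one `decide`. [folklore] -/
theorem rows53C_p49_q2 : ((List.range' 1 12).all fun h₀ => caseCDeadTP 53 3 18 12 [0, 1, 2] [0, 50] h₀ tblZ53C) = true := by
  decide +kernel

/-- The `P`-index-`49` chunk (`P = [0, 50]`) in the form the assembly consumes (glue). [folklore] -/
theorem rows53C_i49 : ((((pShapesC 53 2).drop 49).take 1).all fun P => (qShapesC 3).all fun Q => (List.range' 1 12).all fun h₀ => caseCDeadTP 53 3 18 12 Q P h₀ tblZ53C) = true := by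
  rw [show ((pShapesC 53 2).drop 49).take 1 = [[0, 50]] from by decide, show qShapesC 3 = [[0, 2, 3], [0, 1, 3], [0, 1, 2]] from by decide]
  simp only [List.all_cons, List.all_nil, Bool.and_true, Bool.and_eq_true]
  exact ⟨rows53C_p49_q0, rows53C_p49_q1, rows53C_p49_q2⟩

/-- Case C rows, `P`-indices `[50, 52)` (all `Q`, all holes): one `decide`. [folklore] -/
theorem rows53C_r50_2 : ((((pShapesC 53 2).drop 50).take 2).all fun P => (qShapesC 3).all fun Q => (List.range' 1 12).all fun h₀ => caseCDeadTP 53 3 18 12 Q P h₀ tblZ53C) = true := by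
  decide +kernel

end Summit.MatrixMultiplication.OmegaCensus.CubeNB.S2
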